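import Summits.HubbardSuperconductivity.HubbardSuperconductivity.Theorems.CoherenceWindowLRO.Negative.LoadBearing
import Summits.HubbardSuperconductivity.HubbardSuperconductivity.Theorems.BcsKacWindowCoherenceWindowLROYangSide
import Summits.HubbardSuperconductivity.HubbardSuperconductivity.Theorems.SignStructureSlaterRankBound
import Literature.MathematicalPhysics.QuantumLattice.FreeFermionSectorGroundStates

/-!
# Crux `CoherenceWindowLRO` (item `stmt-HubbardSuperconductivity-1319`): the free torus carries no window condensate

Negative-side calibration for the Yang-side cut of line `birth` (stub `stub_windowCondensate`:
in the coherence window every sector ground state of `hubbardTorus 2 L 1 U` has a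
`ρ₂`-eigenvalue at the condensate-number scale, `c · Δ(U) · L² ≤ λ_max(ρ₂(ψ))`), sorry-free, no
definition introduced.

* `re_rayleigh_twoParticleRDM_pairedState_le_two` / `supRayleigh_twoParticleRDM_pairedState_le_two`
  — **Yang's theorem for the paired Fermi sea, in the crux's vocabulary**: the paired sea
  `Π_{k∈l} c†_{k↑} c†_{-k↓} |0⟩` over a duplicate-free list of momenta is a Slater state of
  plane-wave orbitals (`pairedState_eq_slater`), so every unit-vector Rayleigh quotient of its
  two-particle reduced density matrix is at most `2` (the Slater bound
  `normSq_pairAnnihilator_slater_le` of route `SignStructure`'s proved support `SlaterRankBound`,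
  and Yang's identity `v†ρ₂v = ‖P_v ψ‖²`): `λ_max(ρ₂) ≤ 2`, no pair condensate of any symmetry.
* `exists_unit_free_groundState_supRayleigh_le_two` — hence at every admissible filling the FREE
  torus `hubbardTorus 2 L 1 0` (`L ≥ 3`) has a normalised `(2n, S^z = 0)`-sector ground state with
  `λ_max(ρ₂) ≤ 2` (the paired sea over a Fermi set, `isGroundStateInSector_pairedState_free`).
* `windowCondensate_false_without_interaction` — the statement of `stub_windowCondensate` with
  `hubbardTorus 2 L 1 U` replaced by the free torus in its ground-state clause (pins, window,
  sector, normalisation kept verbatim) is FALSE: in the window `Δ(U)·L ≥ s₀`, so the stub's scale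
  `c Δ(U) L² ≥ c s₀ L` exceeds `2` as soon as `L > 2/(c s₀)`, and the window sides diverge as
  `U → 0⁺` (`window_side_eventually_large`) while wide windows stay inhabited by even tori
  (`exists_even_side_in_upper_window`). Registered one-line form: `freeTorusNoWindowCondensate`.

So both halves of the `birth` cut — the crux's order functional (file `LoadBearing`) and Yang's
`λ_max` (this file) — see the free Fermi sea exactly at the scale the window is designed to
exclude: `32/L²` resp. `2`; the interaction is load-bearing for the stub as for the crux.

Sources: C. N. Yang, Rev. Mod. Phys. 34 (1962) 694, §3 (eigenvalues of `ρ₂` of a Slater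
determinant are bounded); A. J. Coleman, Rev. Mod. Phys. 35 (1963) 668; J. Bardeen, L. N. Cooper,
J. R. Schrieffer, Phys. Rev. 108 (1957) 1175, §II. Folklore finite-dimensional statements
otherwise. Tree: `normSq_pairAnnihilator_slater_le`, `expect_pairAnnihilator_conjTranspose_mul_holds`,
`star_dotProduct_self_eq_normSq`, `pairMode_conjTranspose`, `momentumCreation_eq_sum_planeWave`,
`star_pairedState_dotProduct_self`, `isGroundStateInSector_pairedState_free`, `exists_fermiSet`,
`window_side_eventually_large`, `exists_even_side_in_upper_window`, `natFloor_filling_le_sq`;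
Mathlib: `Real.iSup_le`, `List.ofFn_succ`, `Fin.cons_zero`, `Fin.cons_succ`, `star_mulVec_dotProduct`.
-/

-- the mandated namespace `Summit.<Summit>.<Problem>.Theorems…` repeats `HubbardSuperconductivity`
-- (single-problem summit, D-0017), which the `dupNamespace` linter flags on every declaration
set_option linter.dupNamespace false

noncomputable section

namespace Summit.HubbardSuperconductivity.HubbardSuperconductivity.Theorems.CoherenceWindowLRO.Negative

open Matrix
open Literature.Probability.LatticeModels Literature.MathematicalPhysics.QuantumLattice
open Literature.MathematicalPhysics.QuantumLattice.RayleighBound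
open Literature.Barriers.HubbardSuperconductivity
open Summit.HubbardSuperconductivity.HubbardSuperconductivity.Theorems.SignStructure
  (normSq_pairAnnihilator_slater_le)
open Summit.HubbardSuperconductivity.HubbardSuperconductivity.Theorems.BcsKacWindow
  (window_side_eventually_large)

/-! ### The paired sea is a Slater state of plane waves -/

section Slater

variable {L : ℕ} [NeZero L]

/-- `c†_{kσ}` is the smeared creation operator of the normalised plane wave
`o ↦ L⁻¹ · planeWave k σ o`. [folklore] -/
theorem momentumCreation_eq_create (k : TorusSite 2 L) (σ : Fin 2) :
    momentumCreation k σ =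
      create (fun o : Orb (FermionTorus 2 L) => torusFourierWeight 2 L * planeWave k σ o) := by
  rw [momentumCreation_eq_sum_planeWave]
  rfl

/-- **The paired sea is a Slater state of plane-wave orbitals**: for every list `l` of momenta
there are `N` (`= 2|l|`) orbitals `φ_j` with
`Π_{k∈l} c†_{k↑}c†_{-k↓} |0⟩ = c†(φ₀) ⋯ c†(φ_{N-1}) |0⟩`. Bardeen–Cooper–Schrieffer (1957) §II.
[folklore] -/
theorem pairedState_eq_slater (l : List (TorusSite 2 L)) :
    ∃ (N : ℕ) (φ : Fin N → Orb (FermionTorus 2 L) → ℂ),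
      (l.map fun q : TorusSite 2 L => (pairMode q)ᴴ).prod *ᵥ (vacuum : Fock (Orb (FermionTorus 2 L))) =
        (List.ofFn fun j => create (φ j)).prod *ᵥ (vacuum : Fock (Orb (FermionTorus 2 L))) := by
  induction l with
  | nil => exact ⟨0, Fin.elim0, by rw [List.map_nil, List.ofFn_zero]⟩
  | cons k l ih =>
    obtain ⟨N, φ, h⟩ := ih
    refine ⟨N + 2, Fin.cons (fun o => torusFourierWeight 2 L * planeWave k 0 o)
      (Fin.cons (fun o => torusFourierWeight 2 L * planeWave (-k) 1 o) φ), ?_⟩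
    rw [List.map_cons, List.prod_cons, ← mulVec_mulVec, h, mulVec_mulVec, List.ofFn_succ,
      List.ofFn_succ, List.prod_cons, List.prod_cons, pairMode_conjTranspose,
      momentumCreation_eq_create, momentumCreation_eq_create]
    simp only [Fin.cons_zero, Fin.cons_succ, Matrix.mul_assoc]

omit [NeZero L] in
/-- Yang's identity in norm form: `v† ρ₂(ψ) v = ⟨P_v ψ, P_v ψ⟩`
(`expect_pairAnnihilator_conjTranspose_mul_holds`). Yang (1962) §4, eq. (22). [folklore] -/
theorem star_dotProduct_twoParticleRDM_mulVec_eq (ψ : Fock (Orb (FermionTorus 2 L)))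
    (v : Orb (FermionTorus 2 L) × Orb (FermionTorus 2 L) → ℂ) :
    star v ⬝ᵥ (twoParticleRDM ψ *ᵥ v) = star (pairAnnihilator v *ᵥ ψ) ⬝ᵥ (pairAnnihilator v *ᵥ ψ) := by
  rw [← expect_pairAnnihilator_conjTranspose_mul_holds v ψ,
    Literature.MathematicalPhysics.QuantumLattice.expect, ← mulVec_mulVec, star_mulVec_dotProduct]

/-- **Yang's bound for the paired sea**: for a duplicate-free list `l` of momenta and every unit
pair function `v`, `Re v† ρ₂(Φ_l) v ≤ 2` (`v†ρ₂v = ‖P_v Φ_l‖²`; `‖P_v Φ‖² ≤ 2‖v‖²‖Φ‖²` for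
Slater states, `normSq_pairAnnihilator_slater_le`; `‖Φ_l‖ = 1`). Yang (1962) §3; Coleman (1963).
[folklore] -/
theorem re_rayleigh_twoParticleRDM_pairedState_le_two {l : List (TorusSite 2 L)} (hl : l.Nodup)
    (v : Orb (FermionTorus 2 L) × Orb (FermionTorus 2 L) → ℂ) (hv : star v ⬝ᵥ v = 1) :
    (star v ⬝ᵥ (twoParticleRDM ((l.map fun q : TorusSite 2 L => (pairMode q)ᴴ).prod *ᵥ
        (vacuum : Fock (Orb (FermionTorus 2 L)))) *ᵥ v)).re ≤ 2 := by
  obtain ⟨N, φ, hΦ⟩ := pairedState_eq_slater l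
  have h1 : normSq ((l.map fun q : TorusSite 2 L => (pairMode q)ᴴ).prod *ᵥ
      (vacuum : Fock (Orb (FermionTorus 2 L)))) = 1 := by
    have h := star_pairedState_dotProduct_self hl
    rw [star_dotProduct_self_eq_normSq] at h
    exact_mod_cast h
  have hS : normSq (pairAnnihilator v *ᵥ ((l.map fun q : TorusSite 2 L => (pairMode q)ᴴ).prod *ᵥ
      (vacuum : Fock (Orb (FermionTorus 2 L))))) ≤ 2 * (star v ⬝ᵥ v).re *
        normSq ((l.map fun q : TorusSite 2 L => (pairMode q)ᴴ).prod *ᵥ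
          (vacuum : Fock (Orb (FermionTorus 2 L)))) := by
    rw [hΦ]
    -- `convert`: the Slater bound is stated over a generic ordered orbital type, whose
    -- `DecidableEq` instance (from the linear order) differs syntactically from the one found
    -- for `Orb (FermionTorus 2 L)` here; the discrepancy is closed by subsingleton elimination
    convert normSq_pairAnnihilator_slater_le φ v
  rw [star_dotProduct_twoParticleRDM_mulVec_eq, star_dotProduct_self_eq_normSq, Complex.ofReal_re]
  rw [h1, hv, Complex.one_re] at hS
  linarith

/-- A uniform bound on unit-vector Rayleigh quotients bounds `supRayleigh` (a `⨆` over the unit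
sphere; `Real.iSup_le`, so no nonemptiness is needed for `C ≥ 0`). [folklore] -/
theorem supRayleigh_le_of_forall {m : Type*} [Fintype m] (ρ : Matrix m m ℂ) {C : ℝ} (hC : 0 ≤ C)
    (h : ∀ v : m → ℂ, star v ⬝ᵥ v = 1 → (star v ⬝ᵥ (ρ *ᵥ v)).re ≤ C) : ρ.supRayleigh ≤ C :=
  Real.iSup_le (fun v => h v.1 v.2) hC

/-- **`λ_max(ρ₂) ≤ 2` for the paired sea** (no pair condensate of any symmetry in a Fermi sea).
Yang (1962) §3. [folklore] -/
theorem supRayleigh_twoParticleRDM_pairedState_le_two {l : List (TorusSite 2 L)} (hl : l.Nodup) :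
    (twoParticleRDM ((l.map fun q : TorusSite 2 L => (pairMode q)ᴴ).prod *ᵥ
        (vacuum : Fock (Orb (FermionTorus 2 L))))).supRayleigh ≤ 2 :=
  supRayleigh_le_of_forall _ (by norm_num) fun v hv => re_rayleigh_twoParticleRDM_pairedState_le_two hl v hv

/-- **A normalised free sector ground state without condensate**, at every admissible filling:
for `L ≥ 3` and `n ≤ L²` the FREE torus `hubbardTorus 2 L 1 0` has a unit ground state `ψ` in
the sector `(2n, S^z = 0)` with `λ_max(ρ₂(ψ)) ≤ 2` (the paired sea over a Fermi set of `n`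
lowest band levels). Bardeen–Cooper–Schrieffer (1957) §II; Yang (1962) §3. [folklore] -/
theorem exists_unit_free_groundState_supRayleigh_le_two (hL : 3 ≤ L) {n : ℕ} (hn : n ≤ L ^ 2) :
    ∃ ψ : Fock (Orb (FermionTorus 2 L)), star ψ ⬝ᵥ ψ = 1 ∧
      IsGroundStateInSector (hubbardTorus 2 L 1 0) (2 * n) 0 ψ ∧
        (twoParticleRDM ψ).supRayleigh ≤ 2 := by
  classical
  have hn' : n ≤ Fintype.card (TorusSite 2 L) := by rwa [card_torusSite]
  obtain ⟨F, eF, hFc, hF, hF'⟩ := exists_fermiSet (torusBand L) hn'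
  refine ⟨(F.toList.map fun q : TorusSite 2 L => (pairMode q)ᴴ).prod *ᵥ vacuum,
    star_pairedState_dotProduct_self F.nodup_toList, ?_,
    supRayleigh_twoParticleRDM_pairedState_le_two F.nodup_toList⟩
  rw [← hFc]
  exact isGroundStateInSector_pairedState_free hL F eF hF hF'

end Slater

/-! ### The free torus violates the window-condensate statement -/

/-- **`stub_windowCondensate` is false for the free torus (the interaction is load-bearing for
the Yang-side cut too).** The statement of the stub with `hubbardTorus 2 L 1 U` replaced by the
free torus `hubbardTorus 2 L 1 0` in its ground-state clause — doping window `[a,b] ⊂ (0, 3/10]`,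
pins `e^{-κ₂/U²} ≤ Δ(U) ≤ e^{-κ₁/U²}`, window `s₀ ≤ Δ(U)L ≤ s`, sector, normalisation all kept
verbatim — is FALSE. Proof: at the window top `s = 2s₀` take `U₁(s)`; by
`window_side_eventually_large` and `exists_even_side_in_upper_window` there are `U ∈ (0,U₁)`
and an even window torus of side `L > 2/(c s₀)`; its paired Fermi sea is a normalised free
ground state of the sector with `λ_max(ρ₂) ≤ 2`
(`exists_unit_free_groundState_supRayleigh_le_two`), while the statement demands
`λ_max ≥ c Δ(U) L² ≥ c s₀ L > 2`. Yang (1962) §3. [folklore] -/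
theorem windowCondensate_false_without_interaction :
    ¬ ∃ (a b κ₁ κ₂ c s₀ : ℝ) (Δ : ℝ → ℝ), 0 < a ∧ a < b ∧ b ≤ 3 / 10 ∧ 0 < κ₁ ∧ κ₁ ≤ κ₂ ∧ 0 < c ∧
      0 < s₀ ∧ (∀ U : ℝ, 0 < U → Real.exp (-(κ₂ / U ^ 2)) ≤ Δ U ∧ Δ U ≤ Real.exp (-(κ₁ / U ^ 2))) ∧
      ∀ s : ℝ, s₀ ≤ s → ∃ U₁ : ℝ, 0 < U₁ ∧ ∀ δ ∈ Set.Icc a b, ∀ U ∈ Set.Ioo (0 : ℝ) U₁,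
        ∀ (L : ℕ) [NeZero L], Even L → s₀ ≤ Δ U * L → Δ U * L ≤ s →
          ∀ ψ : Fock (Orb (FermionTorus 2 L)), star ψ ⬝ᵥ ψ = 1 →
            IsGroundStateInSector (hubbardTorus 2 L 1 0) (2 * ⌊(1 - δ) * (L : ℝ) ^ 2 / 2⌋₊) 0 ψ →
              c * Δ U * (L : ℝ) ^ 2 ≤ (twoParticleRDM ψ).supRayleigh := by
  rintro ⟨a, b, κ₁, κ₂, c, s₀, Δ, ha, hab, hb, hκ₁, -, hc, hs₀, hpin, hwin⟩
  have hpin' : ∀ U : ℝ, 0 < U → 0 < Δ U ∧ Δ U ≤ Real.exp (-(κ₁ / U ^ 2)) := fun U hU =>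
    ⟨lt_of_lt_of_le (Real.exp_pos _) (hpin U hU).1, (hpin U hU).2⟩
  -- the window top `s = 2 s₀` and its coupling threshold
  obtain ⟨U₁, hU₁, hW⟩ := hwin (2 * s₀) (by linarith)
  -- below `U₂` every window torus is longer than `L₀ = 2/(c s₀)`
  obtain ⟨U₂, hU₂, hside⟩ :=
    window_side_eventually_large hκ₁ hs₀ (fun U hU => (hpin U hU).2) (2 / (c * s₀))
  -- an admissible coupling and an even torus in the upper quarter of the window
  obtain ⟨U, hUpos, hUlt, m, hm2, hhi, hlo⟩ :=
    exists_even_side_in_upper_window hκ₁ hpin' (show 0 < 2 * s₀ by linarith) (lt_min hU₁ hU₂)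
  have hUU₁ : U < U₁ := lt_of_lt_of_le hUlt (min_le_left _ _)
  have hUU₂ : U < U₂ := lt_of_lt_of_le hUlt (min_le_right _ _)
  have hs₀L : s₀ ≤ Δ U * ((2 * m : ℕ) : ℝ) := by linarith
  have hL₀ : 2 / (c * s₀) < ((2 * m : ℕ) : ℝ) := hside U hUpos hUU₂ (2 * m) hs₀L
  haveI : NeZero (2 * m) := ⟨by omega⟩
  -- the paired Fermi sea of the sector at `δ = a`
  have hn : ⌊(1 - a) * ((2 * m : ℕ) : ℝ) ^ 2 / 2⌋₊ ≤ (2 * m) ^ 2 :=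
    natFloor_filling_le_sq (by linarith) (2 * m)
  obtain ⟨ψ, hψ1, hgs, hlam⟩ := exists_unit_free_groundState_supRayleigh_le_two (L := 2 * m) (by omega) hn
  have key := hW a ⟨le_rfl, hab.le⟩ U ⟨hUpos, hUU₁⟩ (2 * m) (even_two_mul m) hs₀L hhi ψ hψ1 hgs
  -- `c Δ L² = c (Δ L) L ≥ c s₀ L > 2`
  have hcs₀ : 0 < c * s₀ := mul_pos hc hs₀
  have h2 : 2 < c * s₀ * ((2 * m : ℕ) : ℝ) := by
    have := (div_lt_iff₀' hcs₀).1 hL₀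
    linarith
  have h3 : c * s₀ * ((2 * m : ℕ) : ℝ) ≤ c * Δ U * ((2 * m : ℕ) : ℝ) ^ 2 := by
    have hLnn : (0 : ℝ) ≤ ((2 * m : ℕ) : ℝ) := by positivity
    calc c * s₀ * ((2 * m : ℕ) : ℝ) ≤ c * (Δ U * ((2 * m : ℕ) : ℝ)) * ((2 * m : ℕ) : ℝ) := by
          apply mul_le_mul_of_nonneg_right _ hLnn
          exact mul_le_mul_of_nonneg_left hs₀L hc.le
      _ = c * Δ U * ((2 * m : ℕ) : ℝ) ^ 2 := by ring
  linarith

/-- **Registered stub `freeTorusNoWindowCondensate` (crux `stmt-HubbardSuperconductivity-1319`,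
line `birth`).** One-line registered form of `windowCondensate_false_without_interaction`: the
free-torus analogue of `stub_windowCondensate` is false. [folklore] -/
theorem freeTorusNoWindowCondensate : ¬ ∃ (a b κ₁ κ₂ c s₀ : ℝ) (Δ : ℝ → ℝ), 0 < a ∧ a < b ∧ b ≤ 3 / 10 ∧ 0 < κ₁ ∧ κ₁ ≤ κ₂ ∧ 0 < c ∧ 0 < s₀ ∧ (∀ U : ℝ, 0 < U → Real.exp (-(κ₂ / U ^ 2)) ≤ Δ U ∧ Δ U ≤ Real.exp (-(κ₁ / U ^ 2))) ∧ ∀ s : ℝ, s₀ ≤ s → ∃ U₁ : ℝ, 0 < U₁ ∧ ∀ δ ∈ Set.Icc a b, ∀ U ∈ Set.Ioo (0 : ℝ) U₁, ∀ (L : ℕ) [NeZero L], Even L → s₀ ≤ Δ U * L → Δ U * L ≤ s → ∀ ψ : Literature.MathematicalPhysics.QuantumLattice.Fock (Literature.MathematicalPhysics.QuantumLattice.Orb (Literature.MathematicalPhysics.QuantumLattice.FermionTorus 2 L)), star ψ ⬝ᵥ ψ = 1 → Literature.MathematicalPhysics.QuantumLattice.IsGroundStateInSector (Literature.MathematicalPhysics.QuantumLattice.hubbardTorus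 2 L 1 0) (2 * ⌊(1 - δ) * (L : ℝ) ^ 2 / 2⌋₊) 0 ψ → c * Δ U * (L : ℝ) ^ 2 ≤ (Literature.MathematicalPhysics.QuantumLattice.twoParticleRDM ψ).supRayleigh :=
  windowCondensate_false_without_interaction

end Summit.HubbardSuperconductivity.HubbardSuperconductivity.Theorems.CoherenceWindowLRO.Negative

end
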